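import Summits.ResolutionOfSingularities.ResolutionOfSingularities.Theorems.PurelyInseparableDim4ColengthLower
import Summits.ResolutionOfSingularities.ResolutionOfSingularities.Theorems.PurelyInseparableDim4WideNonDropData
import Summits.ResolutionOfSingularities.ResolutionOfSingularities.Theorems.PurelyInseparableDim4NarrowApolarity
import Summits.ResolutionOfSingularities.ResolutionOfSingularities.Theorems.PurelyInseparableDim4DirectrixAtMostTwo
import HarnessLib
import HarnessLib.Audit.Tags

/-!
# A WIDE edge on which `μ⁺` does NOT drop: (N1) `NarrowDrop` does not extend to `ē = 2` — ‖ K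
# (cell `res-dim4-pi`, seat p-7 g2, brick (ι*); specimen = res-dim4-crit-1 T-A-08 / idea-3 P-3-8 (a))

[OURS · counted 0 · a negative fact about a CANDIDATE extension of a cell law, certified in the kernel.]
Nothing here is a statement about resolution of singularities; resolution in dimension ≥ 4 /
characteristic `p` is NOT proved or disproved by anything in this file.

(N1) `RidgeBudget.NarrowDrop p p` is a tree theorem (p-1 g2 `…NarrowDrop`, p662631): along an isolated
`Step0 p` edge from a floor state with a ONE-dimensional ridge (`ē = 1`) the Hasse–Jacobian colength
`μ⁺` drops.  The open core of F4-I(3,3) is the WIDE regime `ē = 2` (`RidgeBudget.NoWideTrap 3 3`,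
p-12 g2 `…RidgeResidual`), where idea-3's CARD I-3-11 census and crit-1's T-A-08 located `μ⁺`-EQUAL
edges.  This file certifies ONE of them in the kernel, over `𝔽₃` (`x, y, u, v = x₀, x₁, x₂, x₃`):

  `P = xy² + 2uv⁴ + 2xu⁴v + x⁴y²v`  —(chart `u`, origin)→  `C = xy² + 2xu³v + 2u²v⁴ + x⁴y²u⁴v`,

both ISOLATED `3`-fold states of order `3` with certificate level `5`, `ē(P) = 2` (ridge `K·e_u ⊕ K·e_v`),
and **`μ⁺(P) = μ⁺(C) = 10`** (the fat point of `C` is `K[u,v] ⧸ (u³, uv³, v⁴)`-shaped: standard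
monomials `1, v, u, v², uv, u², v³, uv², u²v, u²v²`; crit-1 V-A-27 reads it as an AXIS SWAP of the fat
point of `P`).  Ingredients: res-dim4-p-13's `StepKit.step0_of` (the edge), res-dim4-p-8 g2's
`ColengthCert.isoCertB` / `colengthCertB` (isolation, `IsCert`, `μ⁺ ≤ 10`), this seat's dual
functionals `ColengthCert.dualCertB` (`10 ≤ μ⁺`, `…ColengthLower`), p-1 g2's apolarity rows
`NarrowApolarity.mem_additiveSubspace_iff_forall` (`e_u, e_v ∈ A(in P)`) and the tree's
`Directrix.finrank_additiveSubspace_initialForm_le_two` (clean ⇒ `ē ≤ 2`).  Hence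

* **`not_wideDrop_three`** — the statement obtained from `RidgeBudget.NarrowDrop 3 3` by replacing the
  hypothesis `ē = 1` with `ē = 2` is FALSE: `μ⁺` is not a strict Lyapunov function on wide isolated
  edges (it is EQUAL here; T-A-08 also locates rises);
* `jetColength_parent`, `jetColength_child` — the exact rows `μ⁺(P) = 10`, `μ⁺(C) = 10` ‖ K.

Certificate data in `PurelyInseparableDim4WideNonDropData` (found off-tree by this seat's own `𝔽₃`
linear algebra `kb/f3cert.py` / `kb/gen_widenondrop.py` — a further independent implementation of `μ⁺` after
idea-3 `wide.py` and crit-1 `w27.py`, agreeing on `10, 10` at level `5`) and only CHECKED here by `decide +kernel`.  bears_on: LADDER-RESOLUTION:D157-DOOR2 (res-dim4-pi · wide core · μ⁺ rows ‖ K · I-3-11 / T-A-08).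
Supports stmt-ResolutionOfSingularities-16155 (helper).
-/

set_option linter.dupNamespace false -- mandated namespace of this single-conjunct summit

noncomputable section

open MvPolynomial Finset

namespace Summit.ResolutionOfSingularities.ResolutionOfSingularities.Theorems.PIDim4

namespace WideNonDrop

open StepKit ScopeCover ColengthCert
open Literature.AlgebraicGeometry.Resolution
open Literature.AlgebraicGeometry.Resolution.Hauser2010
open Literature.AlgebraicGeometry.Resolution.HauserPerlega2019
open Literature.Barriers.ResolutionOfSingularities
open PointBlowup (additiveSubspace)

/-! ## §1 The presented states, the edge, isolation, the colength rows

Data (term lists `LP`, `LC` and the certificates `RP`, `RC`, `BP`, `BC`, `SP`, `SC`, `DP`, `DC`) in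
`PurelyInseparableDim4WideNonDropData`. -/

/-- `P` presented (no boundary). [folklore] -/
def sP : SData 4 (ZMod 3) := ⟨LP, ![0, 0, 0, 0], ∅⟩

/-- `C` presented (boundary `{u = 0}` of multiplicity `0`). [folklore] -/
def sC : SData 4 (ZMod 3) := ⟨LC, ![0, 0, 0, 0], {2}⟩

/-- The edge `P → C`: point blow-up, chart `u = x₂`, origin. [folklore] -/
theorem step_PC : Step0 3 sP.toState sC.toState :=
  step0_of 2 0 (by decide) rfl (by decide) (by decide) (by decide)

/-- `P` is an isolated `3`-fold point (certificate level `5`). [folklore] -/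
theorem isIsolated_parent : IsIsolated 3 sP.toState.F :=
  isIsolated_of_isoCertB (N := 5) (cert := RP) (by decide +kernel)

/-- `C` is an isolated `3`-fold point (certificate level `5`). [folklore] -/
theorem isIsolated_child : IsIsolated 3 sC.toState.F :=
  isIsolated_of_isoCertB (N := 5) (cert := RC) (by decide +kernel)

/-- `IsCert 3 5 P`. [folklore] -/
theorem isCert_parent : RidgeBudget.IsCert 3 5 sP.toState.F := isCert_of_isoCertB (cert := RP) (by decide +kernel)

/-- `IsCert 3 5 C`. [folklore] -/
theorem isCert_child : RidgeBudget.IsCert 3 5 sC.toState.F := isCert_of_isoCertB (cert := RC) (by decide +kernel)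

/-- `μ⁺(P) ≤ 10` (spanning rows). [folklore] -/
theorem jetColength_parent_le : RidgeBudget.jetColength 3 5 sP.toState.F ≤ 10 :=
  jetColength_le_of_colengthCertB (B := BP) (cert := SP) (by decide +kernel)

/-- `10 ≤ μ⁺(P)` (dual rows). [folklore] -/
theorem le_jetColength_parent : 10 ≤ RidgeBudget.jetColength 3 5 sP.toState.F :=
  length_le_jetColength_of_dualCertB (D := DP) (by decide +kernel)

/-- `μ⁺(C) ≤ 10` (spanning rows). [folklore] -/
theorem jetColength_child_le : RidgeBudget.jetColength 3 5 sC.toState.F ≤ 10 :=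
  jetColength_le_of_colengthCertB (B := BC) (cert := SC) (by decide +kernel)

/-- `10 ≤ μ⁺(C)` (dual rows). [folklore] -/
theorem le_jetColength_child : 10 ≤ RidgeBudget.jetColength 3 5 sC.toState.F :=
  length_le_jetColength_of_dualCertB (D := DC) (by decide +kernel)

/-- **`μ⁺(P) = 10`** ‖ K. [OURS · ‖ K] [folklore] -/
theorem jetColength_parent : RidgeBudget.jetColength 3 5 sP.toState.F = 10 :=
  le_antisymm jetColength_parent_le le_jetColength_parent

/-- **`μ⁺(C) = 10`** ‖ K. [OURS · ‖ K] [folklore] -/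
theorem jetColength_child : RidgeBudget.jetColength 3 5 sC.toState.F = 10 :=
  le_antisymm jetColength_child_le le_jetColength_child

/-! ## §2 The parent is a WIDE floor state: `ord₀ P = 3`, `ē(P) = 2` -/

/-- `ord₀ P = 3`. [folklore] -/
theorem ordZero_parent : ordZero sP.toState.F = 3 := by
  rw [SData.toState_F, ordZero_evalT]; decide

/-- A term list none of whose live exponents is a `q`-th power exponent presents a CLEAN polynomial.
[cite: HauserPerlega2019, §2 (cleaning)] -/
theorem isClean_evalT_of_live {q : ℕ} {L : Terms 4 (ZMod 3)}
    (h : (live L).all (fun e => !decide (∀ i, q ∣ e i)) = true) :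
    HauserPerlega.IsClean q (evalT L) := by
  intro d hd hp
  rw [mem_support_evalT_iff] at hd
  simp only [List.all_eq_true, Bool.not_eq_true', decide_eq_false_iff_not] at h
  exact h _ hd ((isPthPowerExponent_expo_iff q ⇑d).mp (by rwa [expo_coe]))

/-- `P` is clean. [folklore] -/
theorem isClean_parent : HauserPerlega.IsClean 3 sP.toState.F := by
  rw [SData.toState_F]
  exact isClean_evalT_of_live (by decide)

/-- The degree-`3` part of `P` is the single monomial `xy²`: every degree-`3` exponent involving `u`
or `v` has coefficient `0`. [folklore] -/
theorem coeff_parent_eq_zero {d : Fin 4 →₀ ℕ} (hd : d.degree = 3) (huv : 0 < d 2 ∨ 0 < d 3) :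
    coeff d sP.toState.F = 0 := by
  rw [SData.toState_F, coeff_evalT]
  refine coeffAt_eq_zero_of_forall_ne fun t ht hte => ?_
  have hsum : ∑ i, t.1 i = 3 := by rw [hte, ← ColengthCert.degree_eq_sum_coe, hd]
  have h2 : t.1 2 = d 2 := by rw [hte]
  have h3 : t.1 3 = d 3 := by rw [hte]
  simp only [sP, LP, List.mem_cons, List.not_mem_nil, or_false] at ht
  rcases ht with rfl | rfl | rfl | rfl <;> simp [Fin.sum_univ_four] at hsum h2 h3
  omega

/-- `e_u, e_v ∈ A(in P)` (apolarity rows: the degree-`2` Hasse layer of `xy²` does not see `u, v`).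
[folklore] -/
theorem single_mem_additiveSubspace_parent {k : Fin 4} (hk : k = 2 ∨ k = 3) :
    (Pi.single k 1 : Fin 4 → ZMod 3) ∈ additiveSubspace (initialForm sP.toState.F) := by
  rw [NarrowApolarity.mem_additiveSubspace_iff_forall (q := 3) ordZero_parent]
  intro β hβ
  refine Finset.sum_eq_zero fun i _ => ?_
  by_cases hik : i = k
  · subst hik
    rw [coeff_parent_eq_zero (by rw [NarrowApolarity.degree_add_single]; omega) ?_, zero_mul,
      mul_zero]
    rcases hk with rfl | rfl
    · left; simp
    · right; simp
  · rw [Pi.single_eq_of_ne hik, zero_mul]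

/-- **`ē(P) = 2`**: `≥ 2` from the two independent ridge vectors `e_u, e_v`, `≤ 2` because `P` is a
clean floor state (`Directrix.finrank_additiveSubspace_initialForm_le_two`). [folklore] -/
theorem ebar_parent : RidgeBudget.ebar sP.toState.F = 2 := by
  haveI : Fact (Nat.Prime 3) := ⟨Nat.prime_three⟩
  refine le_antisymm
    (Directrix.finrank_additiveSubspace_initialForm_le_two 3 ordZero_parent isClean_parent) ?_
  have hli : LinearIndependent (ZMod 3) ![(Pi.single 2 1 : Fin 4 → ZMod 3), Pi.single 3 1] := by
    rw [LinearIndependent.pair_iff]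
    intro s t hst
    have h2 := congrFun hst 2
    have h3 := congrFun hst 3
    simp at h2 h3
    exact ⟨h2, h3⟩
  have hle : Submodule.span (ZMod 3) (Set.range ![(Pi.single 2 1 : Fin 4 → ZMod 3), Pi.single 3 1]) ≤
      additiveSubspace (initialForm sP.toState.F) := by
    rw [Submodule.span_le]
    rintro _ ⟨i, rfl⟩
    fin_cases i
    · exact single_mem_additiveSubspace_parent (Or.inl rfl)
    · exact single_mem_additiveSubspace_parent (Or.inr rfl)
  have h := Submodule.finrank_mono hle
  rw [finrank_span_eq_card hli, Fintype.card_fin] at h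
  exact h

/-! ## §3 (N1) does not extend to the wide regime -/

/-- **`μ⁺` is NOT a strict Lyapunov function on WIDE isolated edges at `p = 3`**: the statement
`RidgeBudget.NarrowDrop 3 3` with its hypothesis `ē(s) = 1` replaced by `ē(s) = 2` is FALSE, by the
edge `P → C` above (`μ⁺ = 10 → 10`). [OURS · ‖ K · negative] [folklore] -/
theorem not_wideDrop_three :
    ¬ (∀ (K : Type) [Field K] [CharP K 3] [DecidableEq K] (s s' : State K) (N N' : ℕ),
        IsIsolated 3 s.F → IsIsolated 3 s'.F → Step0 3 s s' → ordZero s.F = 3 →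
          RidgeBudget.ebar s.F = 2 → RidgeBudget.IsCert 3 N s.F → RidgeBudget.IsCert 3 N' s'.F →
            RidgeBudget.jetColength 3 N' s'.F < RidgeBudget.jetColength 3 N s.F) := by
  intro h
  have hlt := h (ZMod 3) sP.toState sC.toState 5 5 isIsolated_parent isIsolated_child step_PC
    ordZero_parent ebar_parent isCert_parent isCert_child
  rw [jetColength_parent, jetColength_child] at hlt
  exact lt_irrefl _ hlt

/-- The same with the wide hypothesis in `NoWideTrap`'s form `2 ≤ ē(s)`. [OURS · ‖ K · negative] [folklore] -/
theorem not_wideDrop_three' :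
    ¬ (∀ (K : Type) [Field K] [CharP K 3] [DecidableEq K] (s s' : State K) (N N' : ℕ),
        IsIsolated 3 s.F → IsIsolated 3 s'.F → Step0 3 s s' → ordZero s.F = 3 →
          2 ≤ RidgeBudget.ebar s.F → RidgeBudget.IsCert 3 N s.F → RidgeBudget.IsCert 3 N' s'.F →
            RidgeBudget.jetColength 3 N' s'.F < RidgeBudget.jetColength 3 N s.F) := by
  intro h
  have hlt := h (ZMod 3) sP.toState sC.toState 5 5 isIsolated_parent isIsolated_child step_PC
    ordZero_parent ebar_parent.ge isCert_parent isCert_child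
  rw [jetColength_parent, jetColength_child] at hlt
  exact lt_irrefl _ hlt

/-- **A wide isolated floor EDGE with `μ⁺` EQUAL exists** (positive packaging of the specimen).
[OURS · ‖ K] [folklore] -/
theorem exists_wide_edge_jetColength_eq :
    ∃ (s s' : State (ZMod 3)), IsIsolated 3 s.F ∧ IsIsolated 3 s'.F ∧ Step0 3 s s' ∧
      ordZero s.F = 3 ∧ RidgeBudget.ebar s.F = 2 ∧ RidgeBudget.IsCert 3 5 s.F ∧
        RidgeBudget.IsCert 3 5 s'.F ∧
          RidgeBudget.jetColength 3 5 s.F = 10 ∧ RidgeBudget.jetColength 3 5 s'.F = 10 :=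
  ⟨sP.toState, sC.toState, isIsolated_parent, isIsolated_child, step_PC, ordZero_parent, ebar_parent,
    isCert_parent, isCert_child, jetColength_parent, jetColength_child⟩

end WideNonDrop

end Summit.ResolutionOfSingularities.ResolutionOfSingularities.Theorems.PIDim4

end
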